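import Literature.AnabelianGeometry.EtaleTheta.FrobenioidCyclotomicRigidity
import HarnessLib

/-!
# [EtTh] Prop. 5.5, proof p.328 (PDF p.102) l.2–8: the transport step with VARYING `l·N`-codomains —
# the print-faithful reachability predicate `ReachableFromCodomains` (statement + reductions)

Mochizuki, *The étale theta function and its Frobenioid-theoretic manifestations*, Publ. RIMS **45** (2009), proof of
Prop. 5.5, p.328 (PDF p.102) l.2–8: «Thus, we may transport this isomorphism from `S″` to an arbitrary
`(l, N)`-theta-saturated `S ∈ Ob(C)` by means of linear morphisms `S″ → S`, `S″ → S‴` [of `C` — cf. [FrdI],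
Definition 1.3, (i), (b)], which induce isomorphisms `(l·Δ_Θ)_{S″} ⊗ ℤ/Nℤ ⥲ (l·Δ_Θ)_S ⊗ ℤ/Nℤ`; … `μ_N(S) ⥲ μ_N(S″)`»
[cite: MochizukiEtTh2009, Prop 5.5 proof p.328 (PDF p.102)] — where `S″` ranges over the «`l·N`-codomains of
`l·N`-th roots of right fraction-pairs of `Θ̈`» (p.327 l.−6) and [FrdI] Def. 1.3 (i)(b) (tree:
`Frobenioids.IsFrobenioid.i_b`) moves between objects with isomorphic bases through a COMMON pre-step source.

abc-iut cell, layer L2, plan/L2/SUBDAG-EtTh-Thm56.md input row **P55-L05**; abc-iut-L2-lead ROW #3 for seat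
abc-iut-w5-d123 and RULING F-w5d123-3 (2026-08-26T03:32Z, quantifier level, class «typed stronger than print»):
abc-iut-L2-t4's named input `FrobenioidCyclotomicRigidity.LinearlyReachableFromBN 𝔉` (FrobenioidCyclotomicRigidity.lean,
FROZEN; it STAYS, with a docstring note at its next touch) fixes the SOURCE `B_N` — a cone under the one codomain of
the data — whereas print transports through VARYING codomains `S″`; at the genuine carrier `ofBiKummerData` the fixed-source
form needs `Hom_D(B_N^bs, S^bs) ≠ ∅` for EVERY theta-saturated `S`, which Def. 5.4 does not supply.  This file adds
(APPEND-ONLY discipline: a NEW statement, nothing of abc-iut-L2-t4's file is edited or restated) the print-shaped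
predicate, with the class of admissible sources as a PARAMETER `IsCod : C → Prop` (the §5 data type `ThetaFrobenioid`
carries a single codomain `B_N` and no predicate «is an `l·N`-codomain of an `l·N`-th root of a right fraction-pair of
`Θ̈`» — abc-iut-L2-t4's tower/root vocabulary `NthRoot`/`ThetaFrobenioidTower` is where a consumer instantiates
`IsCod`; until then it is a named binder, per the ruling):

* `ReachableFromCodomains 𝔉 IsCod` — every `(l,N)`-theta-saturated `S` receives, from SOME admissible source `S″`
  (`IsCod S″`), a linear `φ : S″ ⟶ S` inducing a surjection on `(l·Δ_Θ) ⊗ ℤ/Nℤ` and an injection on `μ_N`;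
* `reachableFromCodomains_of_linearlyReachableFromBN` — the typed fixed-source row is the SPECIAL CASE «`B_N` itself is
  admissible and reaches everything» (so nothing consuming the old input is weakened by switching);
  `reachableFromCodomains_mono` — monotone in the admissible class;
* `reachableFromCodomains_of_supply` — the predicate assembled from its three printed supplies: (hcod) an admissible
  source with a linear arrow to each theta-saturated `S` (Prop. 5.2 (i) at varying coverings + [FrdI] Def. 1.3
  (i)(b)); (hΔ) linear arrows out of admissible sources are onto on `(l·Δ_Θ) ⊗ ℤ/Nℤ` (a law of the subquotient
  datum, MERGE-PLAN row 2 / GAP-LEDGER G-w5d123-2 class); (hμ) and injective on `μ_N` (faithfulness of the unit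
  pull-back along base morphisms + Def. 5.4 (a)) — at abc-iut-L2-t4's carrier `ThetaFrobenioid.ofBiKummerData` these
  three are exactly what remains NAMED (the assembly is logic), recorded here so the assembly rows P55-A / T56-L09
  (abc-iut-w5-d020) can bind the print-shaped input;
* `rigidityFamily_eq_of_agree_on_codomains` — the UNIQUENESS use (print: «independent of the choice of `S″`, `S‴` and
  the linear morphisms … precisely because of the original "functoriality"»): two rigidity families functorial for
  linear morphisms that agree on every theta-saturated admissible source agree everywhere (abc-iut-L2-t4's
  `rigidityFamily_unique_of`, re-run with the varying source).

HONEST FRAMING: definitions of `Prop`s over the free §5 datum and elementary reductions; nothing of [EtTh] is asserted;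
[EtTh] is refereed; nothing here bears on [IUTchIII] Cor. 3.12; typed ≠ proved.
-/

namespace Literature.AnabelianGeometry.EtaleTheta

open CategoryTheory

universe w v v' u u'

namespace FrobenioidCyclotomicRigidity

variable {C : Type u} [Category.{v} C] {D : Type u'} [Category.{v'} D] (𝔉 : ThetaFrobenioid.{w} C D)

/-- **[EtTh] Prop. 5.5, transport step, print-faithful form** (proof p.328 (PDF p.102) l.2–8: «we may transport this
isomorphism from `S″` to an arbitrary `(l, N)`-theta-saturated `S ∈ Ob(C)` by means of linear morphisms `S″ → S`, …
which induce isomorphisms `(l·Δ_Θ)_{S″} ⊗ ℤ/Nℤ ⥲ (l·Δ_Θ)_S ⊗ ℤ/Nℤ`; … `μ_N(S) ⥲ μ_N(S″)`»), with the class of admissible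
sources `S″` («`l·N`-codomains of `l·N`-th roots of right fraction-pairs of `Θ̈`», p.327 l.−6) as the parameter `IsCod`
(a named binder until the tower/root vocabulary pins it; ruling F-w5d123-3): EVERY `(l,N)`-theta-saturated `S`
receives from SOME admissible `S″` a LINEAR morphism inducing a surjection `(l·Δ_Θ)_{S″} ⊗ ℤ/Nℤ ↠ (l·Δ_Θ)_S ⊗ ℤ/Nℤ`
and an injection `μ_N(S) ↪ μ_N(S″)` (bijections at theta-saturated ends by Def. 5.4).  Compare the fixed-source
`LinearlyReachableFromBN` (source `B_N` only — stronger than print).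
[cite: MochizukiEtTh2009, Prop 5.5 proof p.328 (PDF p.102)] -/
def ReachableFromCodomains (IsCod : C → Prop) : Prop :=
  ∀ S : C, 𝔉.IsThetaSaturated S → ∃ (S'' : C) (_ : IsCod S'') (φ : S'' ⟶ S), 𝔉.IsLinear φ ∧
    Function.Surjective (𝔉.lDeltaModNMap φ) ∧ Function.Injective (𝔉.muTorsionPull φ 𝔉.N)

/-- The fixed-source row is the special case «`B_N` is admissible and reaches every theta-saturated object»:
`LinearlyReachableFromBN 𝔉` implies `ReachableFromCodomains 𝔉 IsCod` as soon as `IsCod B_N` (so consumers of the old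
input lose nothing).  [cite: MochizukiEtTh2009, Prop 5.5 proof p.328 (PDF p.102)] -/
theorem reachableFromCodomains_of_linearlyReachableFromBN {IsCod : C → Prop} (hB : IsCod 𝔉.BN)
    (h : LinearlyReachableFromBN 𝔉) : ReachableFromCodomains 𝔉 IsCod := by
  intro S hS
  obtain ⟨φ, hlin, hsurj, hinj⟩ := h S hS
  exact ⟨𝔉.BN, hB, φ, hlin, hsurj, hinj⟩

/-- Monotonicity in the admissible class. [cite: MochizukiEtTh2009, Prop 5.5 proof p.328 (PDF p.102)] -/
theorem reachableFromCodomains_mono {IsCod IsCod' : C → Prop} (hle : ∀ S, IsCod S → IsCod' S)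
    (h : ReachableFromCodomains 𝔉 IsCod) : ReachableFromCodomains 𝔉 IsCod' := by
  intro S hS
  obtain ⟨S'', hc, φ, hlin, hsurj, hinj⟩ := h S hS
  exact ⟨S'', hle S'' hc, φ, hlin, hsurj, hinj⟩

/-- **The three printed supplies assemble the predicate** (this is logic; it records the SHAPES of what a carrier must
provide): (hcod) every theta-saturated `S` receives a LINEAR arrow from some admissible source (Prop. 5.2 (i) at varying
coverings + [FrdI] Def. 1.3 (i)(b), p.328 l.2–4); (hΔ) linear arrows out of admissible sources into theta-saturated
objects are onto on `(l·Δ_Θ) ⊗ ℤ/Nℤ` («induce isomorphisms `(l·Δ_Θ)_{S″} ⊗ ℤ/Nℤ ⥲ (l·Δ_Θ)_S ⊗ ℤ/Nℤ`», l.5–6; a law of the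
subquotient datum `lDeltaMap`); (hμ) and injective on `μ_N` («`μ_N(S) ⥲ μ_N(S″)`», l.7–8; faithfulness of the unit
pull-back along base morphisms together with Def. 5.4 (a)).  [cite: MochizukiEtTh2009, Prop 5.5 proof p.328 (PDF p.102)] -/
theorem reachableFromCodomains_of_supply {IsCod : C → Prop}
    (hcod : ∀ S : C, 𝔉.IsThetaSaturated S → ∃ (S'' : C) (_ : IsCod S'') (φ : S'' ⟶ S), 𝔉.IsLinear φ)
    (hΔ : ∀ {S'' S : C} (φ : S'' ⟶ S), IsCod S'' → 𝔉.IsThetaSaturated S → 𝔉.IsLinear φ →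
      Function.Surjective (𝔉.lDeltaModNMap φ))
    (hμ : ∀ {S'' S : C} (φ : S'' ⟶ S), IsCod S'' → 𝔉.IsThetaSaturated S → 𝔉.IsLinear φ →
      Function.Injective (𝔉.muTorsionPull φ 𝔉.N)) :
    ReachableFromCodomains 𝔉 IsCod := by
  intro S hS
  obtain ⟨S'', hc, φ, hlin⟩ := hcod S hS
  exact ⟨S'', hc, φ, hlin, hΔ φ hc hS hlin, hμ φ hc hS hlin⟩

/-- **Uniqueness through varying sources** (print: «independent of the choice of `S″`, `S‴` and the linear morphisms
`S″ → S`, `S″ → S‴` [precisely because of the original "functoriality" of the isomorphism for `S″`]», p.328 l.8–11):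
two rigidity families that are functorial for linear morphisms and AGREE ON EVERY theta-saturated admissible source
agree on every theta-saturated object — abc-iut-L2-t4's `rigidityFamily_unique_of` with the fixed source `B_N`
replaced by the admissible class.  [cite: MochizukiEtTh2009, Prop 5.5 proof p.328 (PDF p.102)] -/
theorem rigidityFamily_eq_of_agree_on_codomains {IsCod : C → Prop} (hreach : ReachableFromCodomains 𝔉 IsCod)
    {ρ ρ' : RigidityFamily 𝔉} (hρ : IsFunctorialLinear 𝔉 ρ) (hρ' : IsFunctorialLinear 𝔉 ρ')
    (hagree : ∀ (S'' : C), IsCod S'' → ∀ hS'' : 𝔉.IsThetaSaturated S'', ρ S'' hS'' = ρ' S'' hS'')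
    (hcodsat : ∀ S'' : C, IsCod S'' → 𝔉.IsThetaSaturated S'') : ρ = ρ' := by
  funext S hS
  obtain ⟨S'', hc, φ, hlin, hsurj, hinj⟩ := hreach S hS
  apply MulEquiv.ext
  intro y
  obtain ⟨x, rfl⟩ := hsurj y
  apply hinj
  rw [hρ φ hlin (hcodsat S'' hc) hS x, hρ' φ hlin (hcodsat S'' hc) hS x, hagree S'' hc]

end FrobenioidCyclotomicRigidity

end Literature.AnabelianGeometry.EtaleTheta
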